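import Summits.QuantumFields.BalabanUV.T4Continuum.Support.NE7CurvedLiftBookkeepingApproxHomTwoTerm
import Summits.QuantumFields.BalabanUV.T4Continuum.Support.NE3CovariantWeitzenbock
import Summits.QuantumFields.BalabanUV.T4Continuum.Support.BlockAveragePushDirGauge
import HarnessLib

/-!
# NE7CurvedLiftBookkeepingApproxFourTerm — THE CHAIN ROOT RE-CUT WITH THE FOUR-TERM SLICE-SOLVER LETTER: the END chain's root (F135
# `NE7CurvedLiftBookkeepingApproxHomTwoTerm.smallField_vary_of_curvedLetters_approxHomTwoTerm`, two-term letter on a set `S ∋ A − A_N`) with `hG` replaced by the FOUR-TERM letter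
# of F152 on all `W`-tangent fields, the END's KNOWN gauge part `σ` (skew periodic, `‖σ‖_∞ ≤ Ξ`) and a divergence datum `‖D_W^*((A − A_N) + gaugeDir_W σ)‖_∞ ≤ D_v` displayed;
# conclusion `SmallField (W e^{A}) (x + (K_G(τ + ρ + κ + ν) + K_X(α₀ + a_N) + K_D·D_v + K_Ξ·Ξ + c_N + 28α₀²))` — the first file of the O2 re-thread (file 83 of the curved (APE), F153)

Cell `pub-balaban`, rung (B)+1 sub-cell t4, lineage `b2b-balaban-t4-ne7-p1` (CRUX PROVER NE7 #1 = OWNER of row NE7), generation 82; memo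
`t4/b2b-balaban-t4-ne7-p1-g82/LOCALISATION-ROAD.md` §2(d) ∕ O2.  Over F135 `hess_functional_of_curvedLetters_approx` (the functional bound `(τ + ρ + κ + ν)` of `A − A_N` on the tangent
tests) and F131 `NE7CurvedLiftBookkeepingTwoTerm.smallField_vary_of_curl` BY NAME; the four-term letter shape is F152 `NE7SliceLetterFourTerm`'s.
WHY.  Gen 82's power counting (memo §2): the letter one can PROVE at a curved background by sup-norm localisation is four-term — source `K_G·g`, representative sup `K_X·R` (lower
order), the covariant DIVERGENCE of the re-gauged representative `K_D·‖D_W^*(X + gaugeDir_W σ)‖_∞` (massive scalar propagator rows, (H0_W) in the tree), and the known gauge parameter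
`K_Ξ·‖σ‖_∞` (`ad(flux)` + tension).  The END applies its letter to ONE field `X = A − A_N` and KNOWS the gauge part of its representative (road (B): E′'s Landau `Z` pointed by the
block-constant `σ̃`, `‖σ̃‖ ≤ 2θ_u`), so it can supply `σ := σ̃` (or `σ := 0` when the representative is Landau) and a divergence datum — pricing `σ̃` through the divergence instead
would cost `K_D·θ_u`, not closing (memo O2).  THIS file is the root of that re-thread; the successor carries `K_D·D_v + K_Ξ·Ξ` next to `K_X(α₀ + a_N)` through `…DockingStrong → …
→ …RoadBGradientClass` exactly as g80's `…H` re-thread carried `K_X(α₀ + a_N)`, discharging `σ, Ξ, D_v` where `σ̃`, `b₀` and the normal lift's divergence become available.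
WHAT ([folklore]; 0 def, 0 sorry).  **`smallField_vary_of_curvedLetters_approxFourTerm`** — hypotheses = F135's with (`S`, `hTS`, `hG`) ↦ (`hXs` skewness of `A − A_N`, the four-term
letter `h4` on all skew periodic `W`-tangent fields, `σ` skew periodic with `‖σ‖ ≤ Ξ`, `D_v` with `‖covDiv W ((A − A_N) + gaugeDir W σ)‖ ≤ D_v`); conclusion displayed above.
HONEST FRAMING (page 1): bookkeeping over DISPLAYED letters at one configuration; the four-term letter is a HYPOTHESIS SHAPE (its flat instance is F152 `fourTermLetter_flatCfg`; at
curved `W` it is the memo's programme, NOT proved); nothing of Bałaban's asserted; (APE) on curved data NOT proved; NOT ONE-STEP, NOT NE7; spine 0∕9; finite T⁴ rung (B)+1 — NOT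
infinite volume, NOT mass gap, NOT `BetaPertH`, NOT Clay.  Continuum YM on T⁴ ⇐ BetaPertH ∧ nine spine estimates (0/9 proved); BetaPertH ⇐ (D1) ∧ (D4) ∧ CAP+tail; G-an2-4
gates asym, D1 and NE2/3/4.
-/

set_option autoImplicit false

open scoped BigOperators Matrix Matrix.Norms.L2Operator
open NormedSpace Finset Set

namespace Summit.QuantumFields.BalabanUV.T4Continuum.NE7CurvedLiftBookkeepingApproxFourTerm

open Literature.MathematicalPhysics.QuantumFieldTheory.Balaban1983to89
open B7Prop1Explicit B7Prop2Explicit MatrixLog UnitaryModel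
open T4AveragingDeficitWall (IsUnitaryCfg IsSkewDir SmallField vary curlAt dirL1)
open T4AveragingDeficitWallBoundary (IsPeriodicCfg periodBox)
open AveragingDeficitPeriodicCounting (IsPeriodicDir)
open AveragingDeficitMultiLevelPrep (LevelSmall)
open MinimalActionLevels (perWin)
open BlockAveragePushDirGauge (gaugeDir)
open NE3CovariantWeitzenbock (covDiv)
open NE3HessForm (hess dAction)
open NE3TangentCovariantTower (dirIter)
open NE7CurvedLiftBookkeepingTwoTerm (smallField_vary_of_curl)
open NE7CurvedLiftBookkeepingApproxHomTwoTerm (hess_functional_of_curvedLetters_approx)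

noncomputable section

variable {d : ℕ} {n : Type*} [Fintype n] [DecidableEq n]

/-- **`SmallField (W e^{A}) (x + (K_G(τ + ρ + κ + ν) + K_X(α₀ + a_N) + K_D·D_v + K_Ξ·Ξ + c_N + 28α₀²))` FROM THE CURVED LETTERS, APPROXIMATE NORTH, FOUR-TERM SLICE-SOLVER LETTER.**
As F135 with the two-term letter on `S ∋ A − A_N` replaced by: `hXs` (skewness of `A − A_N`), the four-term letter `h4` on all skew `P`-periodic `W`-tangent fields (F152's shape),
a skew `P`-periodic gauge parameter `σ` with `‖σ‖_∞ ≤ Ξ`, and a divergence datum `‖covDiv W ((A − A_N) + gaugeDir W σ)‖_∞ ≤ D_v`. [folklore] -/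
theorem smallField_vary_of_curvedLetters_approxFourTerm [Nonempty n] {L : ℕ} (hL : 1 ≤ L) (k : ℕ) {P : ℕ}
    {W : Site d → Fin d → (Matrix n n ℂ)ˣ} (hW : IsUnitaryCfg W)
    {x : ℝ} (hx : 0 ≤ x) (hs : LevelSmall d L k x) (hWx : SmallField W x)
    {A : Site d → Fin d → Matrix n n ℂ} (hA : IsSkewDir A) (hAP : IsPeriodicDir A (P : ℤ)) {α₀ : ℝ} (hAα : ∀ y μ, ‖A y μ‖ ≤ α₀)
    {AN : Site d → Fin d → Matrix n n ℂ} (hNP : IsPeriodicDir AN (P : ℤ)) {aN : ℝ} (hNsup : ∀ y μ, ‖AN y μ‖ ≤ aN)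
    (hNexact : dirIter L (k + 1) W AN = dirIter L (k + 1) W A)
    {cN : ℝ} (hN7 : ∀ z μ' ν', μ' ≠ ν' → ‖curlAt W AN z μ' ν'‖ ≤ cN)
    {ν : ℝ} (hν : 0 ≤ ν)
    (hNorth : ∀ Y : Site d → Fin d → Matrix n n ℂ, IsSkewDir Y → IsPeriodicDir Y (P : ℤ) → dirIter L (k + 1) W Y = 0 →
      |hess W AN Y (perWin d P)| ≤ ν * dirL1 Y (periodBox (d := d) P))
    (hXs : IsSkewDir (fun y μ => A y μ - AN y μ))
    -- THE FOUR-TERM SLICE-SOLVER LETTER (F152's shape) on all skew periodic `W`-tangent fields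
    {KG KX KD KΞ : ℝ}
    (h4 : ∀ X : Site d → Fin d → Matrix n n ℂ, IsSkewDir X →
      IsPeriodicDir X (P : ℤ) → dirIter L (k + 1) W X = 0 → ∀ R : ℝ, (∀ y κ', ‖X y κ'‖ ≤ R) → ∀ g : ℝ, 0 ≤ g →
      (∀ Y : Site d → Fin d → Matrix n n ℂ, IsSkewDir Y → IsPeriodicDir Y (P : ℤ) → dirIter L (k + 1) W Y = 0 →
        |hess W X Y (perWin d P)| ≤ g * dirL1 Y (periodBox (d := d) P)) →
      ∀ σ : Site d → Matrix n n ℂ, (∀ y, σ y ∈ skewAdjoint (Matrix n n ℂ)) →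
      (∀ (y : Site d) (i : Fin d), σ (y + (P : ℤ) • e i) = σ y) → ∀ Ξ : ℝ, (∀ y, ‖σ y‖ ≤ Ξ) →
      ∀ D : ℝ, (∀ y, ‖covDiv W (fun z κ => X z κ + gaugeDir W σ z κ) y‖ ≤ D) →
      ∀ z μ' ν', μ' ≠ ν' → ‖curlAt W X z μ' ν'‖ ≤ KG * g + KX * R + KD * D + KΞ * Ξ)
    -- the END's known gauge part and the divergence datum of the re-gauged difference field
    {σ : Site d → Matrix n n ℂ} (hσs : ∀ y, σ y ∈ skewAdjoint (Matrix n n ℂ)) (hσP : ∀ (y : Site d) (i : Fin d), σ (y + (P : ℤ) • e i) = σ y)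
    {Ξ : ℝ} (hσΞ : ∀ y, ‖σ y‖ ≤ Ξ)
    {Dv : ℝ} (hDv : ∀ y, ‖covDiv W (fun z κ => (A z κ - AN z κ) + gaugeDir W σ z κ) y‖ ≤ Dv)
    {ρ : ℝ} (hρ : 0 ≤ ρ)
    (hEXP : ∀ Y : Site d → Fin d → Matrix n n ℂ, IsSkewDir Y → IsPeriodicDir Y (P : ℤ) →
      |dAction (vary W A 1) Y (perWin d P) - dAction W Y (perWin d P) - hess W A Y (perWin d P)| ≤ ρ * dirL1 Y (periodBox (d := d) P))
    {κ : ℝ} (hκ : 0 ≤ κ)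
    (hWten : ∀ Y : Site d → Fin d → Matrix n n ℂ, IsSkewDir Y → IsPeriodicDir Y (P : ℤ) → dirIter L (k + 1) W Y = 0 →
      |dAction W Y (perWin d P)| ≤ κ * dirL1 Y (periodBox (d := d) P))
    (hcrit : ∀ Y' : Site d → Fin d → Matrix n n ℂ, IsSkewDir Y' → IsPeriodicDir Y' (P : ℤ) → dirIter L (k + 1) (vary W A 1) Y' = 0 →
      dAction (vary W A 1) Y' (perWin d P) = 0)
    {τ : ℝ} (hτ : 0 ≤ τ)
    (hTT : ∀ Y : Site d → Fin d → Matrix n n ℂ, IsSkewDir Y → IsPeriodicDir Y (P : ℤ) → dirIter L (k + 1) W Y = 0 →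
      ∃ Y' : Site d → Fin d → Matrix n n ℂ, IsSkewDir Y' ∧ IsPeriodicDir Y' (P : ℤ) ∧ dirIter L (k + 1) (vary W A 1) Y' = 0 ∧
        |dAction (vary W A 1) (fun y μ => Y' y μ - Y y μ) (perWin d P)| ≤ τ * dirL1 Y (periodBox (d := d) P)) :
    SmallField (vary W A 1) (x + (KG * (τ + ρ + κ + ν) + KX * (α₀ + aN) + KD * Dv + KΞ * Ξ + cN + 28 * α₀ ^ 2)) := by
  obtain ⟨hXP, hXT, hsrc⟩ := hess_functional_of_curvedLetters_approx hL k hW hx hs hWx A hAP hNP hNexact hNorth hEXP hWten hcrit hTT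
  have hXsup : ∀ y κ', ‖(fun y μ => A y μ - AN y μ) y κ'‖ ≤ α₀ + aN := fun y κ' =>
    (norm_sub_le _ _).trans (add_le_add (hAα y κ') (hNsup y κ'))
  have hcurlX : ∀ z μ' ν', μ' ≠ ν' →
      ‖curlAt W (fun y κ' => A y κ' - AN y κ') z μ' ν'‖ ≤ KG * (τ + ρ + κ + ν) + KX * (α₀ + aN) + KD * Dv + KΞ * Ξ :=
    h4 _ hXs hXP hXT (α₀ + aN) hXsup (τ + ρ + κ + ν) (add_nonneg (add_nonneg (add_nonneg hτ hρ) hκ) hν) hsrc σ hσs hσP Ξ hσΞ Dv hDv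
  have h := smallField_vary_of_curl hW hWx hA hAα hN7 hcurlX
  have heq : x + (KG * (τ + ρ + κ + ν) + KX * (α₀ + aN) + KD * Dv + KΞ * Ξ + cN + 28 * α₀ ^ 2)
      = x + ((KG * (τ + ρ + κ + ν) + KX * (α₀ + aN) + KD * Dv + KΞ * Ξ) + cN + 28 * α₀ ^ 2) := by ring
  rw [heq]
  exact h

end

end Summit.QuantumFields.BalabanUV.T4Continuum.NE7CurvedLiftBookkeepingApproxFourTerm
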